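import Literature.NumberTheory.EllipticCurves.Greenberg1999.NoProperFiniteIndexSubmoduleH1Sigma
import Literature.NumberTheory.EllipticCurves.IwasawaSelmerModuleFiniteProofs
import Literature.NumberTheory.EllipticCurves.KodairaNeronUnramifiedInertiaProofs
import Literature.NumberTheory.EllipticCurves.GeomPointsGaloisModule
import Literature.NumberTheory.EllipticCurves.SubgroupSelmerCocycleCriteriaProofs
import HarnessLib

/-!
# `H¹(K_Σ/K_∞, E[p^∞])[𝔪]` is finite and its Pontryagin dual is finitely generated over `Λ`:
# discharge of `Greenberg1999.finite_dual_H1Sigma` (LNM 1716, proof of Prop. 4.9, p. 117 L1)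

Proofs file (theorems only). Cell `bsd-2adic`, seat `bsd-2adic-t42` (BRIEF-T42), GEN 14: the named fact
`Greenberg1999.finite_dual_H1Sigma` (sibling statement file `NoProperFiniteIndexSubmoduleH1Sigma`) —
«the Pontryagin dual of `H¹(ℚ_Σ/ℚ_∞, E[p^∞])` is a finitely generated `Λ`-module» (Greenberg, LNM 1716,
p. 117 L1: "Let `X` denote the Pontryagin dual of `H¹(F_Σ/F, 𝒜)`. Since `X` is a finitely generated
`Λ`-module …"; for odd `p` Greenberg 1989 Prop. 3) — is PROVED, by the argument the tree already runs for
`Sel_{p^∞}(E/K_∞)` in `SelmerInftyTorsionFiniteProofs` (Greenberg §1 p. 60: "`X/𝔪X` is finite … By a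
version of Nakayama's Lemma"), with the Selmer condition replaced by «unramified outside `Σ`»:

* §1 `resOfLe_eq_zero_of_mem_unramifiedOutside` — (B') if the image in `H¹(H, E[p^∞])` of
  `y ∈ H¹(H, E[p])` lies in `unramifiedOutside H E[p^∞] p Σ₀` (unramified at the CHOSEN place above each
  good `v ∉ Σ₀`, `v ∤ p`, for every conjugate), then `y` restricts to `0` on EVERY inertia group
  `I_𝔓 ≤ H`, `𝔓` above such `v`: transport to the chosen prime (`mem_inertia_smul_iff`,
  `exists_smul_eq_of_mem_primesAbove_holds`, the condition for `conj_{g⁻¹}`), local–global inertia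
  (`exists_mem_inertia_apply_eq_holds`, Neukirch II (9.6)), and the reduction step
  `smul_localPoints_eq_of_mem_inertia_holds` (AEC VIII.1.4: inertia at a good `v ∤ p` fixes `E[p^∞]`),
  which kills the coboundary `σ₀ b − b` that a merely unramified class leaves;
* §2 `finite_setOf_unramifiedOutside_pTorsion_conjH1_eq` — (C') for the cyclotomic `ℤ_p`-extension and
  `Σ₀` finite containing the bad places prime to `p`: `{c ∈ H¹(K_Σ/K_∞, E[p^∞]) | p c = 0, conj_γ c = c}`
  is finite (Kummer lift (A) of the tree, §1, the tree's descent theorem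
  `finite_setOf_conjH1_eq_of_unramified_of` with Silverman X.4.3);
* §3 `finite_dual_H1Sigma_holds` — the canonical dual datum `Hom(H¹(ℚ_Σ/ℚ_∞, E[p^∞]), ℚ/ℤ)` with the
  `Λ`-structure `IwasawaDual.IsLocNil.module` is an `IwasawaDual.IsDualPair`, hence finitely generated by
  the dual Nakayama lemma `IsDualPair.module_finite` (Lang, *Cyclotomic Fields*, Ch. 5 §1) and §2.

References: [GreenbergLNM1716] §1 p. 60, §4 p. 117; [Greenberg1989] §3 Prop. 3; [SilvermanAEC2009]
X.4.3–4.4, VIII.1.4; [NeukirchANT1999] II (9.6); [Lang1990] Ch. 5 §1.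
-/

set_option autoImplicit false

open CategoryTheory Literature.NumberTheory.EllipticCurves Literature.NumberTheory.GaloisRepresentations
  Literature.NumberTheory.EllipticCurves.GreenbergSelmer Literature.NumberTheory.EllipticCurves.GreenbergVatsal2000

universe u

noncomputable section

namespace WeierstrassCurve

open scoped Classical AddSubgroup Pointwise

open NumberField IsDedekindDomain

/-! ## §1. (B') Classes unramified at the chosen place (for all conjugates) vanish on every `I_𝔓` -/

section Unramified

variable {K : Type u} [Field K] [NumberField K] (W : WeierstrassCurve K) (p : ℕ) [Fact p.Prime]
  (H : Subgroup (Field.absoluteGaloisGroup K)) [H.Normal]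

omit [Fact p.Prime] [H.Normal] in
/-- Cocycle criterion for the Literature condition `unramifiedKer` (same body as the X2 lineage's
`unramKer`): the class of `f` is unramified at the chosen place above `v` iff `f` is principal on
`H ⊓ I_v`. [folklore] -/
private theorem oneCocycleClass_mem_unramifiedKer_iff (v : HeightOneSpectrum (𝓞 K))
    (f : contOneCocycles (discreteTopRep H (W.geomPrimaryTorsion p))) :
    oneCocycleClass (discreteTopRep H (W.geomPrimaryTorsion p)) f ∈
        unramifiedKer H (W.geomPrimaryTorsion p) v ↔
      ∃ m : W.geomPrimaryTorsion p, ∀ x : inertiaIn H v, f.1 (inertiaInToH H v x) = x • m - m := by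
  rw [GreenbergVatsal2000.unramifiedKer, AddMonoidHom.mem_ker,
    CocycleCriteria.resH1Hom_oneCocycleClass_eq_zero_iff]
  rfl

variable {W p H}

omit [Fact p.Prime] in
/-- **(B') A `p`-torsion class of `H¹(H, E[p^∞])` which is unramified at the chosen place above `v`
for every conjugate — i.e. lies in `unramifiedOutside H E[p^∞] p Σ₀` — has a Kummer lift `y ∈ H¹(H, E[p])`
vanishing on EVERY inertia group `I_𝔓 ≤ H` above a good `v ∉ Σ₀`, `v ∤ p`.** Transport to the prime of
the chosen embedding (`𝔓 = g • 𝔓₀`, the condition for `conj_{g⁻¹}`), lift `g⁻¹ τ g ∈ I_{𝔓₀}` to the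
local inertia group (Neukirch II (9.6)), and use that local inertia at a good `v ∤ p` fixes the
`p`-power torsion point `b` of the coboundary (AEC VIII.1.4), so that `φ(τ) = 0`. Same skeleton as the
tree's `resOfLe_eq_zero_of_mem_selmerGroupOver` (Selmer condition ⇒ unramified).
[cite: SilvermanAEC2009, Cor. X.4.4 and Prop. VIII.1.4] [cite: NeukirchANT1999, Ch. II §9 Prop. (9.6)] -/
theorem resOfLe_eq_zero_of_mem_unramifiedOutside [W.IsElliptic] {S₀ : Set (HeightOneSpectrum (𝓞 K))}
    {y : Literature.NumberTheory.EllipticCurves.subgroupH1 H (geomTorsion W (p : ℤ))}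
    (hy : W.torsionToPrimaryH1Sub p H y ∈ unramifiedOutside H (W.geomPrimaryTorsion p) p S₀)
    {v : HeightOneSpectrum (𝓞 K)} (hvS : v ∉ S₀) (hv : v ∉ W.badPlaces (𝓞 K))
    (hpv : ((p : ℕ) : 𝓞 K) ∉ v.asIdeal)
    {𝔓 : Ideal (absIntegers (𝓞 K) K)} (h𝔓 : 𝔓 ∈ v.primesAbove)
    (hle : 𝔓.inertia (Field.absoluteGaloisGroup K) ≤ H) :
    Literature.NumberTheory.EllipticCurves.resOfLe (geomTorsion W (p : ℤ)) hle y = 0 := by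
  obtain ⟨φ, rfl⟩ := oneCocycleClass_surjective _ y
  -- base prime `𝔓₀` from the chosen embedding and a local prime `𝔐`, and `g` with `g • 𝔓₀ = 𝔓`
  obtain ⟨𝔐, h𝔐⟩ := v.localPrimesAbove_nonempty
  obtain ⟨w, hw⟩ := v.exists_spectralValuation
  set ι₀ := closureEmb (K := K) (v.adicCompletion K) with hι₀
  obtain ⟨g, hg⟩ := HeightOneSpectrum.exists_smul_eq_of_mem_primesAbove_holds
    (HeightOneSpectrum.primeBelow_mem_primesAbove (ι := ι₀) h𝔐) h𝔓
  -- the unramified condition at `v`, conjugated by `g⁻¹`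
  have hunr := (mem_unramifiedOutside_iff _).mp hy v hvS hpv g⁻¹
  rw [torsionToPrimaryH1Sub_oneCocycleClass] at hunr
  -- cocycle-level form of `conj_{g⁻¹}`
  have hc : ∀ (x : H) (m : geomPrimaryTorsion W p),
      DistribSMul.toAddMonoidHom _ g⁻¹ (subgroupConj H g⁻¹ x • m) =
        x • DistribSMul.toAddMonoidHom _ g⁻¹ m := fun x m ↦ by
    simp only [DistribSMul.toAddMonoidHom_apply, Subgroup.smul_def, subgroupConj_apply_coe,
      smul_smul, mul_assoc, mul_inv_cancel_left]
  set ψ := contOneCocycles.push (AddSubgroup.inclusion (geomTorsion_le_geomPrimaryTorsion W p))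
    (fun _ _ ↦ rfl) φ with hψ
  have hconj : W.conjH1 p H g⁻¹ (oneCocycleClass _ ψ) = oneCocycleClass _
      (contOneCocycles.pullback (subgroupConj H g⁻¹)
        (resHomOfEquivariant (subgroupConj H g⁻¹) (DistribSMul.toAddMonoidHom _ g⁻¹) hc) ψ) :=
    map_oneCocycleClass _ _ _ ψ
  have hunr' : oneCocycleClass _ (contOneCocycles.pullback (subgroupConj H g⁻¹)
        (resHomOfEquivariant (subgroupConj H g⁻¹) (DistribSMul.toAddMonoidHom _ g⁻¹) hc) ψ) ∈
      unramifiedKer H (W.geomPrimaryTorsion p) v := by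
    rw [← hconj]; exact hunr
  -- principal on `H ⊓ I_v`: `∃ b, ψ'(x) = x • b - b`
  have hb' := (oneCocycleClass_mem_unramifiedKer_iff W p H v
    (contOneCocycles.pullback (subgroupConj H g⁻¹)
      (resHomOfEquivariant (subgroupConj H g⁻¹) (DistribSMul.toAddMonoidHom _ g⁻¹) hc) ψ)).mp hunr'
  obtain ⟨b, hb⟩ := hb'
  -- goal: `φ` vanishes on `I_𝔓`
  have hvan : ∀ τ : Field.absoluteGaloisGroup K, ∀ hτ : τ ∈ 𝔓.inertia (Field.absoluteGaloisGroup K),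
      φ.1 ⟨τ, hle hτ⟩ = 0 := by
    intro τ hτ
    -- `σ₀ = g⁻¹ τ g ∈ I_{𝔓₀}` and a local `σ'` above it
    have hσ₀ : g⁻¹ * τ * g ∈ (v.primeBelow ι₀ 𝔐).inertia (Field.absoluteGaloisGroup K) := by
      rw [← mem_inertia_smul_iff, hg]; exact hτ
    obtain ⟨σ', hσ'I, hσ'⟩ :=
      HeightOneSpectrum.exists_mem_inertia_apply_eq_holds v ι₀ h𝔐 hσ₀
    have hres : resGalOfEmb ι₀ σ' = g⁻¹ * τ * g := resGalOfEmb_eq_of_apply_eq ι₀ hσ'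
    have hσ₀H : g⁻¹ * τ * g ∈ H := by
      have := Subgroup.Normal.conj_mem inferInstance τ (hle hτ) g⁻¹
      simpa using this
    -- `σ₀ ∈ D_v` and `σ₀ ∈ I_v` (the groups of the CHOSEN embedding)
    have habs : absGaloisRestrict K (v.adicCompletion K) σ' = g⁻¹ * τ * g := by
      rw [← resGal_eq_absGaloisRestrict, resGal_eq, ← hι₀]; exact hres
    have hσ'abs : σ' ∈ absInertia (v.adicCompletion K) := by
      rw [← IsDedekindDomain.HeightOneSpectrum.inertia_eq_absInertia hw h𝔐]; exact hσ'I
    have hdec : g⁻¹ * τ * g ∈ decomp (K := K) v := ⟨σ', habs⟩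
    have hin : g⁻¹ * τ * g ∈ inertia (K := K) v := Subgroup.mem_map.2 ⟨σ', hσ'abs, habs⟩
    let x₀ : inertiaIn H v := ⟨⟨g⁻¹ * τ * g, hdec⟩, (mem_inertiaIn_iff H v _).2 ⟨hσ₀H, hin⟩⟩
    have key := hb x₀
    -- unfold the pulled-back cocycle at `x₀`
    have e0 : subgroupConj H g⁻¹ (inertiaInToH H v x₀) = ⟨τ, hle hτ⟩ :=
      Subtype.ext (by
        rw [subgroupConj_apply_coe]
        change g⁻¹⁻¹ * (g⁻¹ * τ * g) * g⁻¹ = τ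
        group)
    have e1 : (contOneCocycles.pullback (subgroupConj H g⁻¹)
        (resHomOfEquivariant (subgroupConj H g⁻¹) (DistribSMul.toAddMonoidHom _ g⁻¹) hc) ψ).1
          (inertiaInToH H v x₀) =
        g⁻¹ • AddSubgroup.inclusion (geomTorsion_le_geomPrimaryTorsion W p) (φ.1 ⟨τ, hle hτ⟩) := by
      rw [contOneCocycles.pullback_apply, e0]
      rfl
    rw [e1] at key
    -- `x₀ • b = σ₀ • b = b`: local inertia at a good `v ∤ p` fixes the `p`-power torsion point `b`
    have hx₀b : x₀ • b = (g⁻¹ * τ * g) • b := rfl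
    obtain ⟨k, hk⟩ := (AddCommGroup.mem_primaryComponent).1 b.2
    have hn : ((((p ^ k : ℕ) : ℤ)) : 𝓞 K) ∉ v.asIdeal := by
      rw [Int.cast_natCast, Nat.cast_pow]
      exact fun h ↦ hpv (v.isPrime.mem_of_pow_mem _ h)
    set P : localPoints W (v.adicCompletion K) := pointsMapOfEmb W ι₀ (b : geomPoints W) with hP
    have hequiv : pointsMapOfEmb W ι₀ (((g⁻¹ * τ * g) • b : geomPrimaryTorsion W p) : geomPoints W) =
        σ' • P := by
      rw [primaryComponent.coe_smul, ← hres, pointsMapOfEmb_smul]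
    have hkb : p ^ k • b = 0 :=
      Subtype.ext (by rw [AddSubgroupClass.coe_nsmul, ZeroMemClass.coe_zero]; exact hk)
    have htor : p ^ k • ((g⁻¹ * τ * g) • b - b) = 0 := by
      rw [smul_sub, smul_comm, hkb, smul_zero, sub_self]
    have hfix : σ' • P = P := by
      refine W.smul_localPoints_eq_of_mem_inertia_holds v hv hn h𝔐 hσ'I ?_
      rw [← hequiv, hP, ← map_sub, natCast_zsmul, ← map_nsmul, ← AddSubgroupClass.coe_sub,
        ← AddSubgroupClass.coe_nsmul, htor, ZeroMemClass.coe_zero, map_zero]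
    have hbb : (g⁻¹ * τ * g) • b = b := by
      have h1 : pointsMapOfEmb W ι₀ (((g⁻¹ * τ * g) • b : geomPrimaryTorsion W p) : geomPoints W) =
          pointsMapOfEmb W ι₀ (b : geomPoints W) := by rw [hequiv, hfix]
      exact Subtype.ext (pointsMapOfEmb_injective W ι₀ h1)
    rw [hx₀b, hbb, sub_self] at key
    -- injectivity of the inclusions
    have h2 : AddSubgroup.inclusion (geomTorsion_le_geomPrimaryTorsion W p) (φ.1 ⟨τ, hle hτ⟩) = 0 := by
      rwa [smul_eq_zero_iff_eq] at key
    exact (injective_iff_map_eq_zero _).mp (AddSubgroup.inclusion_injective _) _ h2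
  -- conclude: the restriction to `I_𝔓` is the class of the zero cocycle
  have hmap : Literature.NumberTheory.EllipticCurves.resOfLe (geomTorsion W (p : ℤ)) hle
      (oneCocycleClass _ φ) = oneCocycleClass _
      (contOneCocycles.pullback (subgroupInclusion hle)
        (resHomOfEquivariant (subgroupInclusion hle) (AddMonoidHom.id (geomTorsion W (p : ℤ)))
          (fun _ _ ↦ rfl)) φ) :=
    map_oneCocycleClass _ _ _ φ
  rw [hmap, oneCocycleClass_eq_zero_iff]
  refine ⟨0, fun τ ↦ ?_⟩
  rw [contOneCocycles.pullback_apply, map_zero, sub_zero]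
  exact hvan τ τ.2

end Unramified

/-! ## §2. (C') `H¹(K_Σ/K_∞, E[p^∞])[𝔪]` is finite -/

section Finite

variable {K : Type u} [Field K] [NumberField K] (W : WeierstrassCurve K) {p : ℕ} [Fact p.Prime]
  (κ : ZpExtension K p)

/-- **`H¹(K_Σ/K_∞, E[p^∞])[𝔪]` is finite**: for an elliptic curve over a number field, ANY
`ℤ_p`-extension `κ` with topological generator `γ` (unramified outside `p` by the tree theorem
`ZpExtension.inertia_le_kerSubgroup_holds`) and a finite `Σ₀`, the set of classes of
`H¹(K_∞, E[p^∞])` unramified above every finite `v ∉ Σ₀`, `v ∤ p` (`unramifiedOutside`), killed by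
`p` and fixed by `conj_γ`, is finite. Assembly as for `Sel_∞[𝔪]`
(`finite_setOf_selmerInfty_pTorsion_conjH1_eq`): Kummer lift (A) with finite kernel `F₀`, §1 in place
of (B), and the descent theorem `finite_setOf_conjH1_eq_of_unramified_of` (Silverman X.4.3) for
`S = Σ₀ ∪ {bad} ∪ {v ∣ p}`. Greenberg (1999) p. 117 L1 / §1 p. 60 ("`X/𝔪X` is finite").
[cite: GreenbergLNM1716, §1 p. 60 and §4 p. 117] [cite: SilvermanAEC2009, Lemma X.4.3] -/
theorem finite_setOf_unramifiedOutside_pTorsion_conjH1_eq [W.IsElliptic]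
    {γ : Field.absoluteGaloisGroup K} (hγ : κ.IsTopGenerator γ)
    {S₀ : Set (HeightOneSpectrum (𝓞 K))} (hS₀ : S₀.Finite) :
    Set.Finite {c : W.subgroupH1 p κ.kerSubgroup |
      c ∈ unramifiedOutside κ.kerSubgroup (W.geomPrimaryTorsion p) p S₀ ∧ p • c = 0 ∧
        W.conjH1 p κ.kerSubgroup γ c = c} := by
  classical
  have hp := (Fact.out : p.Prime)
  have hIκ : ∀ ⦃v : HeightOneSpectrum (𝓞 K)⦄, (p : 𝓞 K) ∉ v.asIdeal →
      ∀ ⦃𝔓 : Ideal (absIntegers (𝓞 K) K)⦄, 𝔓 ∈ v.primesAbove →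
        𝔓.inertia (Field.absoluteGaloisGroup K) ≤ κ.kerSubgroup :=
    fun _ hv _ h𝔓 ↦ ZpExtension.inertia_le_kerSubgroup_holds K p κ hv h𝔓
  -- notation
  let ιN := W.torsionToPrimaryH1Sub p κ.kerSubgroup
  -- the finite set of places
  let S : Set (HeightOneSpectrum (𝓞 K)) :=
    (W.badPlaces (𝓞 K) ∪ {v | ((p : ℤ) : 𝓞 K) ∈ v.asIdeal}) ∪ S₀
  have hbad : (W.badPlaces (𝓞 K)).Finite := W.finite_badPlaces_holds (𝓞 K)
  have hS : S.Finite := (hbad.union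
    (finite_setOf_intCast_mem_asIdeal (by exact_mod_cast hp.ne_zero))).union hS₀
  have hSp : ∀ v : HeightOneSpectrum (𝓞 K), (p : 𝓞 K) ∈ v.asIdeal → v ∈ S := fun v hv ↦
    Or.inl (Or.inr (by simpa using hv))
  -- unramified predicate on `H¹(N, E[p])`
  let Unr : Literature.NumberTheory.EllipticCurves.subgroupH1 κ.kerSubgroup (geomTorsion W (p : ℤ)) → Prop := fun x ↦
    ∀ v : HeightOneSpectrum (𝓞 K), v ∉ S → ∀ 𝔓 ∈ v.primesAbove,
      ∀ hle : 𝔓.inertia (Field.absoluteGaloisGroup K) ≤ κ.kerSubgroup,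
        Literature.NumberTheory.EllipticCurves.resOfLe (geomTorsion W (p : ℤ)) hle x = 0
  have hUnr_sub : ∀ x y, Unr x → Unr y → Unr (x - y) := fun x y hx hy v hv 𝔓 h𝔓 hle ↦ by
    rw [map_sub, hx v hv 𝔓 h𝔓 hle, hy v hv 𝔓 h𝔓 hle, sub_zero]
  -- (D) the `γ`-invariant unramified classes are finite
  haveI : Finite (geomTorsion W (p : ℤ)) :=
    finite_torsionPoints_holds W (AlgebraicClosure K) (by exact_mod_cast hp.ne_zero)
  haveI : ContinuousSMul (Field.absoluteGaloisGroup K) (geomTorsion W (p : ℤ)) :=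
    continuousSMul_geomTorsion W (isOpen_stabilizer_point_holds W) _
  have hpM : ∀ m : geomTorsion W (p : ℤ), p • m = 0 := fun m ↦
    Subtype.ext (by rw [AddSubgroupClass.coe_nsmul, ZeroMemClass.coe_zero]; exact
      AddSubgroup.torsionBy.nsmul_iff.mp m.2)
  have hA₀ := finite_setOf_conjH1_eq_of_unramified_of κ (M := geomTorsion W (p : ℤ))
    hγ hpM (finite_h1Unramified_holds K) hIκ hS hSp
  -- (A) the kernel of `ιN` is finite
  have hF₀ := W.finite_ker_torsionToPrimaryH1Sub p (H := κ.kerSubgroup)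
    W.zsmul_geomPoints_surjective_holds
  -- the lifts: `L = {y | ιN y ∈ H_Σ, conj_γ (ιN y) = ιN y}` is finite
  have hL : Set.Finite {y : Literature.NumberTheory.EllipticCurves.subgroupH1 κ.kerSubgroup (geomTorsion W (p : ℤ)) |
      ιN y ∈ unramifiedOutside κ.kerSubgroup (W.geomPrimaryTorsion p) p S₀ ∧
        W.conjH1 p κ.kerSubgroup γ (ιN y) = ιN y} := by
    -- `L ⊆ {y | Unr y ∧ conj_γ y - y ∈ ker ιN}`
    have hsub : {y : Literature.NumberTheory.EllipticCurves.subgroupH1 κ.kerSubgroup (geomTorsion W (p : ℤ)) |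
        ιN y ∈ unramifiedOutside κ.kerSubgroup (W.geomPrimaryTorsion p) p S₀ ∧
          W.conjH1 p κ.kerSubgroup γ (ιN y) = ιN y} ⊆
        ⋃ f ∈ (ιN.ker : Set _), {y | Unr y ∧
          Literature.NumberTheory.EllipticCurves.conjH1 κ.kerSubgroup (geomTorsion W (p : ℤ)) γ y - y = f} := by
      rintro y ⟨hy1, hy2⟩
      simp only [Set.mem_iUnion, Set.mem_setOf_eq, SetLike.mem_coe, exists_prop]
      refine ⟨_, ?_, ?_, rfl⟩
      · rw [AddMonoidHom.mem_ker, map_sub, ← conjH1_torsionToPrimaryH1Sub, hy2, sub_self]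
      · intro v hv 𝔓 h𝔓 hle
        have hv' : v ∉ W.badPlaces (𝓞 K) := fun h ↦ hv (Or.inl (Or.inl h))
        have hpv : (p : 𝓞 K) ∉ v.asIdeal := fun h ↦ hv (hSp v h)
        have hvS₀ : v ∉ S₀ := fun h ↦ hv (Or.inr h)
        exact resOfLe_eq_zero_of_mem_unramifiedOutside (H := κ.kerSubgroup) hy1 hvS₀ hv' hpv h𝔓 hle
    refine (hF₀.biUnion fun f _ ↦ ?_).subset hsub
    -- each piece is empty or a translate of the finite set of (D)
    by_cases hne : {y | Unr y ∧
        Literature.NumberTheory.EllipticCurves.conjH1 κ.kerSubgroup (geomTorsion W (p : ℤ)) γ y - y = f}.Nonempty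
    · obtain ⟨y₀, hy₀U, hy₀⟩ := hne
      refine (hA₀.image fun a ↦ y₀ + a).subset ?_
      rintro y ⟨hyU, hy⟩
      refine ⟨y - y₀, ⟨?_, hUnr_sub y y₀ hyU hy₀U⟩, by abel⟩
      rw [map_sub, sub_eq_iff_eq_add.mp hy, sub_eq_iff_eq_add.mp hy₀]
      abel
    · rw [Set.not_nonempty_iff_eq_empty.mp hne]
      exact Set.finite_empty
  -- conclusion: the target set lies in `ιN '' L`
  refine (hL.image ιN).subset ?_
  rintro c ⟨hcS, hpc, hcγ⟩
  obtain ⟨y, hy⟩ := W.exists_torsionToPrimaryH1Sub_eq p (H := κ.kerSubgroup)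
    W.zsmul_geomPoints_surjective_holds hpc
  refine ⟨y, ⟨?_, ?_⟩, hy⟩
  · show ιN y ∈ _
    rw [show ιN y = c from hy]; exact hcS
  · show W.conjH1 p κ.kerSubgroup γ (ιN y) = ιN y
    rw [show ιN y = c from hy]; exact hcγ

end Finite

/-! ## §3. The canonical dual datum of `H¹(K_Σ/K_∞, E[p^∞])` and the discharge of `finite_dual_H1Sigma` -/

section Dual

variable {K : Type u} [Field K] [NumberField K] (W : WeierstrassCurve K) {p : ℕ} [Fact p.Prime]
  (κ : ZpExtension K p)

omit [NumberField K] in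
/-- Powers of an endomorphism `φ` of a subgroup of `H¹(K_∞, E[p^∞])` which is `conj_γ` on the nose:
`(φ^m) s = conj_{γ^m} s` (`conjH1_one`, `conjH1_mul`). [folklore] -/
private theorem coe_pow_apply_of_coe_eq_conjH1 (γ : Field.absoluteGaloisGroup K)
    (Hsub : AddSubgroup (W.subgroupH1 p κ.kerSubgroup)) (φ : AddMonoid.End Hsub)
    (hφ : ∀ s : Hsub, ((φ s : Hsub) : W.subgroupH1 p κ.kerSubgroup) = W.conjH1 p κ.kerSubgroup γ s)
    (m : ℕ) (s : Hsub) :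
    (((φ ^ m) s : Hsub) : W.subgroupH1 p κ.kerSubgroup) = W.conjH1 p κ.kerSubgroup (γ ^ m) s := by
  induction m generalizing s with
  | zero => rw [pow_zero, pow_zero, AddMonoid.End.one_apply, W.conjH1_one_holds p κ.kerSubgroup,
      AddMonoidHom.id_apply]
  | succ m ih =>
    rw [pow_succ, AddMonoid.End.coe_mul, Function.comp_apply, ih, hφ, pow_succ,
      W.conjH1_mul_holds p κ.kerSubgroup, AddMonoidHom.comp_apply]

/-- **`φ − 1` is locally nilpotent on any `conj_γ`-stable subgroup of the `p`-primary group
`H¹(K_∞, E[p^∞])`** (`IwasawaDual.IsLocNil`), for `φ = conj_γ|` and `γ` a topological generator —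
every class is killed by a power of `p` (`exists_pow_smul_subgroupH1_ker_eq_zero`) and fixed by
`conj_{γ^{p^a}}` (`exists_conjH1_pow_prime_pow_eq`) — as for `Sel_∞` (`isLocNil_conjSelmerInfty_sub_one`).
[cite: GreenbergLNM1716, §1 p. 60] -/
theorem isLocNil_sub_one_of_coe_eq_conjH1 {γ : Field.absoluteGaloisGroup K} (hγ : κ.IsTopGenerator γ)
    (Hsub : AddSubgroup (W.subgroupH1 p κ.kerSubgroup)) (φ : AddMonoid.End Hsub)
    (hφ : ∀ s : Hsub, ((φ s : Hsub) : W.subgroupH1 p κ.kerSubgroup) = W.conjH1 p κ.kerSubgroup γ s) :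
    IwasawaDual.IsLocNil p (φ - 1) := by
  have htor : ∀ s : Hsub, ∃ k : ℕ, p ^ k • s = 0 := fun s ↦ by
    obtain ⟨k, hk⟩ := W.exists_pow_smul_subgroupH1_ker_eq_zero κ (s : W.subgroupH1 p κ.kerSubgroup)
    exact ⟨k, Subtype.ext (by rw [AddSubgroupClass.coe_nsmul]; exact hk)⟩
  refine ⟨htor, fun s ↦ ?_⟩
  obtain ⟨a, ha⟩ := W.exists_conjH1_pow_prime_pow_eq κ hγ (s : W.subgroupH1 p κ.kerSubgroup)
  obtain ⟨k, hk⟩ := htor s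
  have hφa : (φ ^ p ^ a) s = s :=
    Subtype.ext (by rw [coe_pow_apply_of_coe_eq_conjH1 W κ γ Hsub φ hφ]; exact ha)
  exact ⟨k * p ^ a, IwasawaDual.pow_mul_prime_pow_apply_eq_zero (Fact.out : p.Prime) _ a hφa hk⟩

end Dual

/-- **Discharge of `Greenberg1999.finite_dual_H1Sigma`: the Pontryagin dual of `H¹(ℚ_Σ/ℚ_∞, E[p^∞])` is
a finitely generated `Λ`-module** — the canonical datum `Y = Hom(H¹(ℚ_Σ/ℚ_∞, E[p^∞]), ℚ/ℤ)` with the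
`Λ`-structure `IwasawaDual.IsLocNil.module` (`T ↦ conj_γ − 1`, constants through `ℤ_p → ℤ/p^k`) is an
`IsDualPair`, and `IsDualPair.module_finite` (dual Nakayama, Lang Ch. 5 §1) applies because
`H¹(ℚ_Σ/ℚ_∞, E[p^∞])[𝔪]` is finite (§2). Valid for every `p` and every elliptic `E/ℚ`; the hypotheses
«cyclotomic» and «good reduction outside `Σ₀ ∪ {p}`» of the fact are not even needed.
[cite: GreenbergLNM1716, §4 p. 117 (proof of Prop. 4.9) and §1 p. 60] [cite: Lang1990, Ch. 5 §1] -/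
theorem _root_.Literature.NumberTheory.EllipticCurves.Greenberg1999.finite_dual_H1Sigma_holds :
    Greenberg1999.finite_dual_H1Sigma := by
  intro W _ _ p _ κ γ _hκ hγ S₀ _hgood
  -- the restricted conjugation `φ = conj_γ|` on `H = H¹(ℚ_Σ/ℚ_∞, E[p^∞])`
  let φ : AddMonoid.End (unramifiedOutside κ.kerSubgroup (W.geomPrimaryTorsion p) p
      (↑S₀ : Set (HeightOneSpectrum (𝓞 ℚ)))) :=
    AddMonoidHom.mk' (fun c ↦ ⟨W.conjH1 p κ.kerSubgroup γ c,
        conjH1_mem_unramifiedOutside κ.kerSubgroup (W.geomPrimaryTorsion p) p _ γ c.2⟩)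
      (fun a b ↦ Subtype.ext (by
        change W.conjH1 p κ.kerSubgroup γ ((a : W.subgroupH1 p κ.kerSubgroup) + b) =
          W.conjH1 p κ.kerSubgroup γ a + W.conjH1 p κ.kerSubgroup γ b
        exact map_add _ _ _))
  have hφ : ∀ s, ((φ s : unramifiedOutside κ.kerSubgroup (W.geomPrimaryTorsion p) p
      (↑S₀ : Set (HeightOneSpectrum (𝓞 ℚ)))) : W.subgroupH1 p κ.kerSubgroup) =
        W.conjH1 p κ.kerSubgroup γ s := fun _ ↦ rfl
  have h := W.isLocNil_sub_one_of_coe_eq_conjH1 κ hγ _ φ hφ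
  letI := h.module (A := AddCircle (1 : ℚ))
  have hpair : IwasawaDual.IsDualPair p (φ - 1) (AddMonoidHom.id _) :=
    { bijective := Function.bijective_id
      T_smul := fun x s ↦ by
        show h.smulFun PowerSeries.X x s = x _
        rw [h.smulFun_X_apply]
      C_smul := fun c x s k hk ↦ by
        show h.smulFun (PowerSeries.C c) x s = _
        exact h.smulFun_C_apply c x hk
      locNil := h }
  have hfin : (IwasawaDual.piece p (φ - 1) 1 :
      Set (unramifiedOutside κ.kerSubgroup (W.geomPrimaryTorsion p) p
        (↑S₀ : Set (HeightOneSpectrum (𝓞 ℚ))))).Finite := by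
    refine ((W.finite_setOf_unramifiedOutside_pTorsion_conjH1_eq κ hγ S₀.finite_toSet).preimage
      (Subtype.val_injective.injOn)).subset ?_
    intro s hs
    obtain ⟨hs1, hs2⟩ := hs
    rw [pow_one] at hs1 hs2
    rw [IwasawaDual.End_sub_apply, AddMonoid.End.one_apply, sub_eq_zero] at hs2
    refine ⟨s.2, ?_, ?_⟩
    · have h1 := congrArg (fun z : unramifiedOutside κ.kerSubgroup (W.geomPrimaryTorsion p) p
        (↑S₀ : Set (HeightOneSpectrum (𝓞 ℚ))) ↦ (z : W.subgroupH1 p κ.kerSubgroup)) hs1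
      simpa using h1
    · have h2 := congrArg (fun z : unramifiedOutside κ.kerSubgroup (W.geomPrimaryTorsion p) p
        (↑S₀ : Set (HeightOneSpectrum (𝓞 ℚ))) ↦ (z : W.subgroupH1 p κ.kerSubgroup)) hs2
      simpa [hφ] using h2
  haveI : Module.Finite (IwasawaAlgebra p)
      (unramifiedOutside κ.kerSubgroup (W.geomPrimaryTorsion p) p (↑S₀ : Set (HeightOneSpectrum (𝓞 ℚ))) →+
        AddCircle (1 : ℚ)) := hpair.module_finite hfin
  refine ⟨(unramifiedOutside κ.kerSubgroup (W.geomPrimaryTorsion p) p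
      (↑S₀ : Set (HeightOneSpectrum (𝓞 ℚ))) →+ AddCircle (1 : ℚ)), inferInstance, h.module,
    inferInstance, AddMonoidHom.id _, Function.bijective_id, fun y c ↦ ?_, fun a y c k hk ↦ ?_⟩
  · show h.smulFun PowerSeries.X y c = y _ - y c
    rw [h.smulFun_X_apply, IwasawaDual.End_sub_apply, AddMonoid.End.one_apply, map_sub]
    rfl
  · show h.smulFun (PowerSeries.C a) y c = _
    exact h.smulFun_C_apply a y hk

end WeierstrassCurve

end
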